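import Summits.AtomisticToContinuum.HydrodynamicLimit.Theorems.CollisionIsometryCLTAdaptedWeightCLTSAScaleSplitPointwise

/-!
# Stub `stub_scaleSplit` of the line `sustained-anisotropy-superexp` for the crux `AdaptedWeightCLT`
(stmt-AtomisticToContinuum-14868, rev-12 TIME-LOCAL form; `--supports`), file 2/2: the scale split

THE CHAOS-FREE SCALE SPLIT of the crux functional. For EVERY `N`, every admissible block kernel family `φ`
and every cell kernel family `ψ`,
`P{δ < ∫₀ᵗ∫ₓ Σ D² + |q|²} ≤ P{δ/K < CellInt} + P{δ/K < ReynInt}` with the absolute constant `K = 1262`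
(`stub_scaleSplit`, registered signature; pattern of `Reduction.stub_reduction`).

1. POINTWISE ALGEBRA over one block (file 1/2, `ScaleSplit.defectC_le_split`):
   `defectC ≤ 2 · cellA + 1260 · ethC · reyC`.
2. INTEGRABILITY along a good orbit: `cellA`, `ethC · reyC` and `DefectSq` are jointly measurable in `(s, x)`
   (configuration-level measurability of file 1/2 composed with the measurable orbit,
   `Reduction.measurable_flow_of_mem_good`) and bounded on `[0, t] × 𝕋³` (velocities bounded by the velocity
   radius `vR z` along the orbit, `Reduction.norm_vel_flow_le`; weights by the kernel height), so they have
   genuine iterated integrals (`Reduction.integrable_of_bdd`) and step 1 integrates to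
   `∫₀ᵗ∫ₓ DefectSq ≤ 2 · CellInt + 1260 · ReynInt` (`setIntegral_defectSq_le_split`).
3. UNION BOUND: outside `goodᶜ ∪ {δ/K < CellInt} ∪ {δ/K < ReynInt}` the crux event fails
   (`2 δ/K + 1260 δ/K = δ`); `goodᶜ` is null for the local Gibbs law (`ae_mem_good_localGibbsLaw`), and the
   outer measure is monotone and subadditive — at every `N`, so the `∀ᶠ N` is `Filter.Eventually.of_forall`.
-/

namespace Summit.AtomisticToContinuum.HydrodynamicLimit.Theorems.SustainedAnisotropy

open scoped BigOperators Topology Classical MeasureTheory ENNReal InnerProductSpace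
open Filter Set MeasureTheory
open Literature.Analysis.FluidPDE
open Summit.AtomisticToContinuum.HydrodynamicLimit.Theorems.ContactSourceDuhamel
open Summit.AtomisticToContinuum.HydrodynamicLimit.Theorems.ContactSourceDuhamel.TimeLocal
open Summit.AtomisticToContinuum.HydrodynamicLimit.Theorems.ContactBalance
open Literature.MathematicalPhysics.KineticTheory (hsDiameter localGibbsLaw empiricalDensityField
  empiricalMomentumField ae_mem_good_localGibbsLaw)

noncomputable section

namespace ScaleSplit

/-! ## Along a good orbit: boundedness, measurability, the integrated split -/

section Orbit

variable {σ : ℝ} {N : ℕ} {Φ : Flow σ N} {z : Cfg N} {φ : ℕ → T3 → ℝ} (ψ : ℕ → T3 → ℝ) {Cφ t : ℝ}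

/-- The split functionals along a good orbit are bounded on `[0, t] × 𝕋³` (velocities `≤ vR z`). -/
theorem bdd_split (hz : z ∈ Φ.good) (hψ0 : ∀ y, 0 ≤ ψ N y) (hφ0 : ∀ y, 0 ≤ φ N y)
    (hφC : ∀ y, φ N y ≤ Cφ) :
    (∃ B, ∀ s ∈ Icc 0 t, ∀ x, |cellA N φ ψ (Φ.flow s z) x| ≤ B) ∧
      ∃ B, ∀ s ∈ Icc 0 t, ∀ x, |ethC N φ ψ (Φ.flow s z) x * reyC N φ ψ (Φ.flow s z) x| ≤ B := by
  have h := fun s x => abs_split_le ψ (Φ.flow s z) x hψ0 hφ0 hφC (Reduction.vR_nonneg z)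
    (Reduction.norm_vel_flow_le Φ hz s)
  refine ⟨?_, Reduction.bdd_mul ⟨_, fun s _ x => (h s x).2.2.1⟩ ⟨_, fun s _ x => (h s x).2.2.2⟩⟩
  unfold cellA
  exact Reduction.bdd_add
    (Reduction.bdd_sum _ fun j _ => Reduction.bdd_sum _ fun k _ => by
      simpa only [sq] using
        Reduction.bdd_mul ⟨_, fun s _ x => (h s x).1 j k⟩ ⟨_, fun s _ x => (h s x).1 j k⟩)
    (Reduction.bdd_sum _ fun a _ => by
      simpa only [sq] using
        Reduction.bdd_mul ⟨_, fun s _ x => (h s x).2.1 a⟩ ⟨_, fun s _ x => (h s x).2.1 a⟩)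

/-- A functional jointly measurable in `(w, x)` is jointly measurable in `(s, x)` along a good orbit. -/
theorem measurable_orbit (hz : z ∈ Φ.good) {F : Cfg N → T3 → ℝ}
    (hF : Measurable fun q : Cfg N × T3 => F q.1 q.2) :
    Measurable fun p : ℝ × T3 => F (Φ.flow p.1 z) p.2 :=
  (hF.comp (((Reduction.measurable_flow_of_mem_good Φ hz).comp measurable_fst).prodMk measurable_snd) :)

/-- Integrating the pointwise split `D ≤ 2A + 1260 R` against a measure. -/
theorem integral_split_le {α : Type*} [MeasurableSpace α] {μ : Measure α} {D A R : α → ℝ}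
    (hD : Integrable D μ) (hA : Integrable A μ) (hR : Integrable R μ)
    (h : ∀ᵐ y ∂μ, D y ≤ 2 * A y + 1260 * R y) :
    ∫ y, D y ∂μ ≤ 2 * ∫ y, A y ∂μ + 1260 * ∫ y, R y ∂μ := by
  calc ∫ y, D y ∂μ ≤ ∫ y, (2 * A y + 1260 * R y) ∂μ :=
        integral_mono_ae hD ((hA.const_mul 2).add (hR.const_mul 1260)) h
    _ = 2 * ∫ y, A y ∂μ + 1260 * ∫ y, R y ∂μ := by
        rw [integral_add (hA.const_mul 2) (hR.const_mul 1260), integral_const_mul, integral_const_mul]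

/-- **The integrated split on the good set**: for a good datum, continuous kernels `0 ≤ φ_N ≤ Cφ`,
`0 ≤ ψ_N`: `∫₀ᵗ∫ₓ DefectSq ≤ 2 · CellInt + 1260 · ReynInt`. -/
theorem setIntegral_defectSq_le_split (hz : z ∈ Φ.good) (hφc : Continuous (φ N))
    (hψc : Continuous (ψ N)) (hψ0 : ∀ y, 0 ≤ ψ N y) (hφ0 : ∀ y, 0 ≤ φ N y) (hφC : ∀ y, φ N y ≤ Cφ)
    (t : ℝ) :
    ∫ s in Icc 0 t, ∫ x, DefectSq σ N Φ φ s z x ≤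
      2 * CellInt σ N Φ φ ψ t z + 1260 * ReynInt σ N Φ φ ψ t z := by
  have hD := Reduction.integrable_of_bdd t (fun s x => DefectSq σ N Φ φ s z x)
    (Reduction.measurable_defectSq hz hφc) (Reduction.bdd_defectSq hz hφ0 hφC)
  obtain ⟨hbA, hbR⟩ := bdd_split (t := t) ψ hz hψ0 hφ0 hφC
  have hA := Reduction.integrable_of_bdd t (fun s x => cellA N φ ψ (Φ.flow s z) x)
    (measurable_orbit hz (F := cellA N φ ψ) (measurable_cellA_prod hφc hψc)) hbA
  have hR := Reduction.integrable_of_bdd t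
    (fun s x => ethC N φ ψ (Φ.flow s z) x * reyC N φ ψ (Φ.flow s z) x)
    (measurable_orbit hz (F := fun w x => ethC N φ ψ w x * reyC N φ ψ w x)
      ((measurable_ethC_prod hφc hψc).mul (measurable_reyC_prod hφc hψc))) hbR
  have hinner : ∀ s ∈ Icc 0 t, ∫ x, DefectSq σ N Φ φ s z x ≤
      2 * (∫ x, cellA N φ ψ (Φ.flow s z) x) +
        1260 * ∫ x, ethC N φ ψ (Φ.flow s z) x * reyC N φ ψ (Φ.flow s z) x := fun s hs =>
    integral_split_le (hD.1 s hs) (hA.1 s hs) (hR.1 s hs)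
      (ae_of_all _ fun x => defectC_le_split ψ (Φ.flow s z) x hφ0)
  exact integral_split_le hD.2 hA.2 hR.2 ((ae_restrict_iff' measurableSet_Icc).2 (ae_of_all _ hinner))

end Orbit

end ScaleSplit

open ScaleSplit in
/-- **SCALE SPLIT** (`stub_scaleSplit` of the line `sustained-anisotropy-superexp`, registered signature): for
every `N`, `P{δ < ∫₀ᵗ∫ₓ Σ D² + |q|²} ≤ P{δ/K < CellInt} + P{δ/K < ReynInt}` with `K = 1262`. On the good set the
integrated split `∫₀ᵗ∫ₓ DefectSq ≤ 2 · CellInt + 1260 · ReynInt` makes the crux event fail outside the two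
events on the right (`2/K + 1260/K = 1`); the good set has full local Gibbs measure; the outer measure is
monotone and subadditive. Positivity of `σ, γ, t, δ`, `σ < 1/2`, `γ ≤ 1/15` and the cell-kernel clauses other
than continuity and nonnegativity are not used. -/
theorem stub_scaleSplit : ∃ K : ℝ, 0 < K ∧ ∀ σ : ℝ, 0 < σ → σ < 2⁻¹ →
    ∀ (a₀ θ₀ : T3 → ℝ) (u₀ : T3 → V3) (Φ : Flows σ) (γ C : ℝ) (φ : ℕ → T3 → ℝ), 0 < γ → γ ≤ 1 / 15 →
      AdmissibleKernel γ C φ → ∀ (ψ : ℕ → T3 → ℝ) (ℓ : ℕ → ℝ), CellKernel ψ ℓ → ∀ t : ℝ, 0 < t → ∀ δ : ℝ, 0 < δ →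
        ∀ᶠ N : ℕ in atTop,
          localGibbsLaw σ a₀ u₀ θ₀ N (Φ N) {z | δ < ∫ s in Icc 0 t, ∫ x, DefectSq σ N (Φ N) φ s z x} ≤
            localGibbsLaw σ a₀ u₀ θ₀ N (Φ N) {z | K⁻¹ * δ < CellInt σ N (Φ N) φ ψ t z} +
              localGibbsLaw σ a₀ u₀ θ₀ N (Φ N) {z | K⁻¹ * δ < ReynInt σ N (Φ N) φ ψ t z} := by
  refine ⟨1262, by norm_num, ?_⟩
  intro σ _ _ a₀ θ₀ u₀ Φ γ C φ _ _ hadm ψ ℓ hcell t _ δ _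
  refine Filter.Eventually.of_forall fun n => ?_
  have hφc : Continuous (φ n) := (hadm.1 n).continuous
  have hφ0 : ∀ y, 0 ≤ φ n y := hadm.2.1 n
  have hφC : ∀ y, φ n y ≤ C * ((n : ℝ) + 1) ^ (3 * γ) := hadm.2.2.2.2.1 n
  have hψc : Continuous (ψ n) := hcell.1 n
  have hψ0 : ∀ y, 0 ≤ ψ n y := hcell.2.1 n
  have hnull : localGibbsLaw σ a₀ u₀ θ₀ n (Φ n) (Φ n).goodᶜ = 0 :=
    ae_iff.1 (ae_mem_good_localGibbsLaw σ a₀ u₀ θ₀ n (Φ n))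
  -- on the good set, outside the two events, the crux event fails
  have hsub : {z | δ < ∫ s in Icc 0 t, ∫ x, DefectSq σ n (Φ n) φ s z x} ⊆
      ((Φ n).goodᶜ ∪ {z | (1262 : ℝ)⁻¹ * δ < CellInt σ n (Φ n) φ ψ t z}) ∪
        {z | (1262 : ℝ)⁻¹ * δ < ReynInt σ n (Φ n) φ ψ t z} := by
    intro z hzE
    by_contra hnot
    simp only [mem_union, mem_compl_iff, mem_setOf_eq, not_or, not_not, not_lt] at hnot
    obtain ⟨⟨hzG, hIC⟩, hIR⟩ := hnot
    have hmain := setIntegral_defectSq_le_split ψ hzG hφc hψc hψ0 hφ0 hφC t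
    have hE : δ < ∫ s in Icc 0 t, ∫ x, DefectSq σ n (Φ n) φ s z x := hzE
    have hK : (2 : ℝ) * ((1262 : ℝ)⁻¹ * δ) + 1260 * ((1262 : ℝ)⁻¹ * δ) = δ := by ring
    linarith
  calc localGibbsLaw σ a₀ u₀ θ₀ n (Φ n) {z | δ < ∫ s in Icc 0 t, ∫ x, DefectSq σ n (Φ n) φ s z x}
      ≤ localGibbsLaw σ a₀ u₀ θ₀ n (Φ n)
          (((Φ n).goodᶜ ∪ {z | (1262 : ℝ)⁻¹ * δ < CellInt σ n (Φ n) φ ψ t z}) ∪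
            {z | (1262 : ℝ)⁻¹ * δ < ReynInt σ n (Φ n) φ ψ t z}) := measure_mono hsub
    _ ≤ localGibbsLaw σ a₀ u₀ θ₀ n (Φ n) (Φ n).goodᶜ +
          localGibbsLaw σ a₀ u₀ θ₀ n (Φ n) {z | (1262 : ℝ)⁻¹ * δ < CellInt σ n (Φ n) φ ψ t z} +
          localGibbsLaw σ a₀ u₀ θ₀ n (Φ n) {z | (1262 : ℝ)⁻¹ * δ < ReynInt σ n (Φ n) φ ψ t z} :=
        (measure_union_le _ _).trans (add_le_add (measure_union_le _ _) le_rfl)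
    _ = _ := by rw [hnull, zero_add]

end

end Summit.AtomisticToContinuum.HydrodynamicLimit.Theorems.SustainedAnisotropy
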